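import Mathlib
import Summits.Ventures.PercRepro2.SkeletonSimple
import Summits.Ventures.PercRepro2.TypedBundleHarris2

/-!
# The typed residual class is already simple: the «flat ∧ Simple» leg of R-SEP3(8) is void
(blind cell PercRepro2, night-1 g16; NIGHT1-G16.md §1)

The lead's reading of record (STATUS 5962, 10:42Z) named as the candidate leg of R-SEP3(8) the
composed kernel theorem «`HCov_all R` from the crux on every `Skeleton.Simple` instance of the flat
twenty».  This file shows that the leg narrows NOTHING: the typed reduction rules already inside the
flat domain (`TypedRed.Reduced`, TypedResidual.lean — no typed loop, no parallel typed pair, no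
unmarked typed leaf, no unmarked vertex of typed degree two) say exactly that the typed graph
`(V, F)` is `Skeleton.Simple` for the weight vector `𝟙_F` (the indicator of the typed edges):

* **`Skeleton.simple_indicator_of_typedReduced`**: `TypedRed.Reduced ends o a₁ a₂ a₃ b F →
  Skeleton.Simple 𝟙_F ends o a₁ a₂ a₃ b`;
* **`Skeleton.simple_of_flat7SP2H`**: every instance of the flat twenty is `Simple` for `𝟙_F`;
* the composed theorem **`Skeleton.HCov_all_of_flat7SP2HSimple_all`** — the crux of record from
  (TRI) on the flat twenty AND `Simple 𝟙_F` — is therefore a one-line corollary of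
  `TypedRed.HCov_all_of_flat7SP2H_all`, and its hypothesis `FlatDomain7SP2HSimple_all` is
  EQUIVALENT to `FlatDomain7SP2H_all` (`flat7SP2HSimple_all_iff`): the Simple conjunct is redundant
  on the flat domain, so the sentence of record does not move.

Own code; standard axioms.
-/

open scoped Classical

namespace Summit.Ventures.PercRepro2

open UnionCluster CovForm CovForm.TypedRed

namespace Skeleton

section Indicator

variable {V : Type*} {E : Type*} [Fintype E] [DecidableEq E] {R : Type*} [Field R]

/-- The indicator weight vector of the typed edges: `1` on `F`, `0` elsewhere. -/
noncomputable def indicator (F : Finset E) : E → R := fun e => if e ∈ F then 1 else 0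

omit [Fintype E] in
/-- The indicator is nonzero exactly on `F`. -/
lemma indicator_ne_zero_iff (F : Finset E) {e : E} : (indicator F : E → R) e ≠ 0 ↔ e ∈ F := by
  unfold indicator
  by_cases h : e ∈ F <;> simp [h]

/-- The nonzero-degree under the indicator of `F` is the typed degree: the number of typed edges at
`v`. -/
lemma nzDeg_indicator (F : Finset E) (ends : E → Sym2 V) (v : V) :
    nzDeg (indicator F : E → R) ends v = (Finset.univ.filter (fun e => v ∈ ends e ∧ e ∈ F)).card := by
  unfold nzDeg
  congr 1
  ext e
  simp only [Finset.mem_filter, Finset.mem_univ, true_and, indicator_ne_zero_iff]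

/-- **A typed-reduced instance is simple for the indicator of its typed edges**: the typed rules (no
typed loop, no parallel typed pair, no unmarked typed leaf, no unmarked vertex of typed degree two)
are exactly `Skeleton.Simple` for `𝟙_F`. -/
theorem simple_indicator_of_typedReduced (ends : E → Sym2 V) (o a₁ a₂ a₃ b : V)
    (F : Finset E) (h : TypedRed.Reduced ends o a₁ a₂ a₃ b F) :
    Simple (indicator F : E → R) ends o a₁ a₂ a₃ b := by
  refine ⟨?_, ?_, ?_⟩
  · -- `Reduced`: no nonzero loop at an unmarked `v`, nonzero-degree `0` or `≥ 3`
    intro v hvo hv1 hv2 hv3 hvb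
    refine ⟨?_, ?_⟩
    · intro e he hev
      have heF : e ∈ F := (indicator_ne_zero_iff F).1 he
      exact h.no_loop e heF (by rw [hev]; exact Sym2.mk_isDiag_iff.2 rfl)
    · rw [nzDeg_indicator]
      rcases Finset.eq_empty_or_nonempty (Finset.univ.filter (fun e => v ∈ ends e ∧ e ∈ F)) with
        hS | ⟨f, hf⟩
      · left; exact Finset.card_eq_zero.2 hS
      · right
        simp only [Finset.mem_filter, Finset.mem_univ, true_and] at hf
        obtain ⟨hvf, hfF⟩ := hf
        obtain ⟨u, hu⟩ := Sym2.mem_iff_exists.1 hvf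
        have hvu : v ≠ u := fun hvu => h.no_loop f hfF (by rw [hu, hvu]; exact Sym2.mk_isDiag_iff.2 rfl)
        -- the second typed edge at `v` (no unmarked typed leaf)
        obtain ⟨e', he'F, he'f, hve'⟩ := h.no_leaf f hfF v u hu hvu hvo hv1 hv2 hv3 hvb
        obtain ⟨u', hu'⟩ := Sym2.mem_iff_exists.1 hve'
        have hvu' : v ≠ u' := fun hvu' =>
          h.no_loop e' he'F (by rw [hu', hvu']; exact Sym2.mk_isDiag_iff.2 rfl)
        -- the third typed edge at `v` (no unmarked vertex of typed degree two)
        have hfu : ends f = s(u, v) := by rw [hu]; exact Sym2.eq_swap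
        obtain ⟨e'', he''F, he''f, he''e', hve''⟩ :=
          h.no_series f hfF e' he'F (Ne.symm he'f) u v u' hfu hu' hvu hvu' hvo hv1 hv2 hv3 hvb
        have hsub : ({f, e', e''} : Finset E) ⊆ Finset.univ.filter (fun e => v ∈ ends e ∧ e ∈ F) := by
          intro e he
          simp only [Finset.mem_insert, Finset.mem_singleton] at he
          simp only [Finset.mem_filter, Finset.mem_univ, true_and]
          rcases he with rfl | rfl | rfl
          · exact ⟨hvf, hfF⟩
          · exact ⟨hve', he'F⟩
          · exact ⟨hve'', he''F⟩
        have hcard : ({f, e', e''} : Finset E).card = 3 := by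
          rw [Finset.card_insert_of_notMem, Finset.card_insert_of_notMem, Finset.card_singleton]
          · simpa using he''e'.symm
          · simp only [Finset.mem_insert, Finset.mem_singleton, not_or]
            exact ⟨Ne.symm he'f, Ne.symm he''f⟩
        exact hcard ▸ Finset.card_le_card hsub
  · -- no nonzero loop anywhere
    intro e he
    exact h.no_loop e ((indicator_ne_zero_iff F).1 he)
  · -- no parallel nonzero pair
    intro e₁ e₂ h1 h2 hne
    exact h.no_parallel e₁ ((indicator_ne_zero_iff F).1 h1) e₂ ((indicator_ne_zero_iff F).1 h2) hne

/-- Every instance of the flat domain of record (its first condition `ResidualCore` already) is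
`Simple` for the indicator of its typed edges. -/
theorem simple_of_residualCore [DecidableEq V] (ends : E → Sym2 V) (o a₁ a₂ a₃ b : V) (F : Finset E)
    (h : TypedRed.ResidualCore ends o a₁ a₂ a₃ b F) :
    Simple (indicator F : E → R) ends o a₁ a₂ a₃ b :=
  simple_indicator_of_typedReduced ends o a₁ a₂ a₃ b F h.residualConR.residualCon.residual.reduced

end Indicator

section Closure

variable (R : Type*) [Field R] [LinearOrder R] [IsStrictOrderedRing R]

/-- **Row 2′TRI on the flat domain of record AND `Simple 𝟙_F`** (the «flat ∧ Simple» leg of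
R-SEP3(8) as a statement: the twenty flat conditions plus the simplicity of the typed graph). -/
def FlatDomain7SP2HSimple_all : Prop :=
  ∀ (V E : Type) [Fintype V] [DecidableEq V] [Fintype E] [DecidableEq E]
    (ends : E → Sym2 V) (o a₁ a₂ a₃ b : V) (F : Finset E) (τ : E → ℕ),
    (∀ e ∈ F, τ e = 1 ∨ τ e = 2) →
    TypedRed.ResidualCore ends o a₁ a₂ a₃ b F →
    ¬ Hats ends o a₁ a₂ a₃ b F →
    ¬ HasRootCut ends o a₁ a₂ a₃ b F →
    ¬ HasTwoTerminalPart ends o a₁ a₂ a₃ b F →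
    ¬ HasRootBundle ends o a₁ a₂ a₃ b F →
    ¬ RootBridge.HasCutRoots ends o a₁ a₂ a₃ b F →
    ¬ RootBridge.HasCutRootsA3 ends o a₁ a₂ a₃ b F →
    ¬ OneStar ends o a₁ a₂ a₃ b F →
    ¬ RootBridge.MildInst ends o a₁ a₂ a₃ b F (fun _ => false) →
    o ≠ b →
    ¬ RootBridge.OBehindA3 ends o a₁ a₂ a₃ F (fun _ => false) →
    7 ≤ F.card →
    ¬ SepThree.HasSepThree ends o a₁ a₂ a₃ b F →
    ¬ SepThree.HasSepThree ends o a₂ a₁ a₃ b F →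
    ¬ PocketAB.HasPocketAB ends o a₁ a₂ a₃ b F →
    ¬ SepTwo.HasSepTwo ends o a₁ a₂ a₃ b F →
    ¬ PocketA1B.HasPocketA1B ends o a₁ a₂ a₃ b F →
    ¬ PocketA1B.HasPocketA1B ends o a₂ a₁ a₃ b F →
    ¬ PocketOA2.HasPocketOA2 ends o a₁ a₂ a₃ b F →
    ¬ PocketOA2.HasPocketOA2 ends o a₂ a₁ a₃ b F →
    Simple (indicator F : E → R) ends o a₁ a₂ a₃ b →
      0 ≤ typedCount F (fun _ => false) τ
        (K3 ends o a₁ a₂ a₃ b : Config E → Config E → Config E → R)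

omit [IsStrictOrderedRing R] in
/-- **The Simple conjunct is redundant on the flat domain**: the two hypotheses are equivalent. -/
theorem flat7SP2HSimple_all_iff :
    FlatDomain7SP2HSimple_all R ↔ TypedRed.FlatDomain7SP2H_all R := by
  constructor
  · intro hc V E _ _ _ _ ends o a₁ a₂ a₃ b F τ hτ h0 h1 h2 h3 h4 h5 h6 h7 h8 h9 h10 h11 h12 h13 h14
      h15 h16 h17 h18 h19
    exact hc V E ends o a₁ a₂ a₃ b F τ hτ h0 h1 h2 h3 h4 h5 h6 h7 h8 h9 h10 h11 h12 h13 h14 h15 h16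
      h17 h18 h19 (simple_of_residualCore ends o a₁ a₂ a₃ b F h0)
  · intro hc V E _ _ _ _ ends o a₁ a₂ a₃ b F τ hτ h0 h1 h2 h3 h4 h5 h6 h7 h8 h9 h10 h11 h12 h13 h14
      h15 h16 h17 h18 h19 _
    exact hc V E ends o a₁ a₂ a₃ b F τ hτ h0 h1 h2 h3 h4 h5 h6 h7 h8 h9 h10 h11 h12 h13 h14 h15 h16
      h17 h18 h19

/-- **THE COMPOSED THEOREM OF THE «flat ∧ Simple» LEG** — the crux of record from (TRI) on the
flat twenty together with `Simple 𝟙_F`; a corollary of `TypedRed.HCov_all_of_flat7SP2H_all` because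
the extra conjunct is implied by the first condition. -/
theorem HCov_all_of_flat7SP2HSimple_all (hc : FlatDomain7SP2HSimple_all R) : HCov_all R :=
  TypedRed.HCov_all_of_flat7SP2H_all R ((flat7SP2HSimple_all_iff R).1 hc)

end Closure

end Skeleton

end Summit.Ventures.PercRepro2
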